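import Literature.MathematicalPhysics.QuantumFieldTheory.Balaban1983to89.B9Eq3153FrakGLipschitz
import Literature.MathematicalPhysics.QuantumFieldTheory.Balaban1983to89.B9Eq386LipschitzH1TwoBackgrounds

/-!
# `Balaban1983to89.B9Eq3153FrakGLipschitzTwoBackgrounds` — T. Bałaban, *Propagators for lattice gauge theories in a background field*, Commun. Math.
# Phys. **99** (1985) 389–434 [Balaban1985BackgroundPropagators] (3.153) p. 426 with Thm 3.4 p. 400 ∕ (3.86) p. 407: AT A FIXED LATTICE THE pub-balaban
# NE9 CHAIN'S `𝔊(U) = G₁ − H₁QG₁ − G₁DRD*G₁` ((3.153) ∕ [Balaban1985Variational] (111)) IS LIPSCHITZ IN THE BACKGROUND BETWEEN TWO SMALL-BOND BACKGROUNDS —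
# `‖𝔊(U)x − 𝔊(U′)x‖ ≤ C₃·δ·‖x‖` for `‖U(b) − 1‖, ‖U′(b) − 1‖ ≤ ε ≤ ε₈`, `‖U(b) − U′(b)‖ ≤ δ`: the telescoping of `B9Eq386ResolventLetters` on this
# lineage's two-background letters of `G₁, H₁` ((Q2)₂), `Q` ((δ_Q)₂), `D, D*` ((B)₂), `R` ((Q3a)₂)

statement-level skeleton of published theorems with citation tags; proofs where landed; nothing here is a claim about the Yang–Mills mass gap

PDF held: `paper:balaban1985-cmp99-background-propagators` (journal page = PDF page + 388); pp. 400, 407, 425–426 through the verbatim quotations of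
`B9Eq3153FrakGLipschitz` (NE9 owner gen 81), whose proof this file runs a second time between two backgrounds.

CITATION HEADER (lean-in-tree rule 2026-08-18).  Audit cell `pub-balaban`, sub-cell `t4`, NE9 crux team (2): LEAF PROVER 04
(`b2b-balaban-t4-ne9-formalise-leaf-04` gen 73) — the TWO-BACKGROUND twin of the NE9 owner's (Q3) `B9Eq3153FrakGLipschitz.exists_lipschitz_frakG_at_flat`,
the fourth junction above this lineage's two-background letters for the owner's census item (i) «two general small fields» (journal `CLAIMS.log`
l.42142); with it every letter of the owner's (B′) `B11Eq117LetterDefects` (`𝔊`, `H₁`) has a two-background Lipschitz bound in the tree.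

THE PRINT (as quoted in `B9Eq3153FrakGLipschitz` ∕ `B9Eq386LipschitzH1`).  p. 400, Thm 3.4: *«… small perturbations of the operators depending on U
only»*; (3.86) p. 407; (3.153) p. 426 (the operator `𝔊`); [Balaban1985Variational] (110)–(111) p. 294.

WHAT IS PROVED (sorry-free; no `Prop` placeholder; no inequality of the paper asserted).
* **`exists_lipschitz_frakG_twoBackgrounds`** — `∃ C₃ ε₈ > 0 ∀ U U′` (their `QtorusW` letters, `‖U(b) − 1‖, ‖U′(b) − 1‖ ≤ ε ≤ ε₈`, `‖U(b) − U′(b)‖ ≤ δ`,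
  `hRS`, `hRS′`) `∀ hpos hQ` (at `U`) `∀ hpos′ hQ′` (at `U′`) `∀ x`: `‖𝔊(U)x − 𝔊(U′)x‖ ≤ C₃·δ·‖x‖` — `B9Eq386ResolventLetters.norm_frakG_formula_sub_le`
  with the BOUNDS `‖G₁(V)‖ ≤ γ₁⁻¹` (`B9Thm311SmallFieldGreen`), `‖H₁(U′)‖ ≤ C_H` (`B9Eq3126H1Bound`), `‖Q(V)‖ ≤ ‖Q(1)‖ + C_Q^♭`, `‖D‖, ‖D*‖ ≤ 4|η|⁻¹√d`,
  `‖R‖ ≤ 1` at both backgrounds, and the DIFFERENCES `δ_G = C₁δ`, `δ_H = C₂δ` ((Q2)₂), `δ_Q = C_Q·δ` ((δ_Q)₂ §6), `δ_D = |η|⁻¹·2M_φM_φ′δ·√d` ((B)₂),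
  `δ_R = C_R·δ` ((Q3a)₂).
MODEL / HONEST SCOPE.  [folklore] finite-dimensional perturbation theory at a FIXED lattice; `C₃, ε₈` depend on `L, m, η, c₀, c₁, a, M_φ, M_φ′, C_τ`; both
backgrounds in the small-bond ball; NOT analyticity in `A`, NOT uniformity in the lattice; NOT summit progress (cell pub-balaban: NE9 NOT PRINTED ∕ NOT
PROVED; spine PROVED 0∕9; rung (B)+1 finite T⁴ — NOT infinite volume, NOT mass gap, NOT BetaPertH, NOT Clay).  NEW file importing `B9Eq3153FrakGLipschitz`,
`B9Eq386LipschitzH1TwoBackgrounds`; nothing of the NE9-owner lineage's files is modified.  Net new unproved facts: 0.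
-/

noncomputable section

open scoped InnerProductSpace ComplexConjugate

namespace Literature.MathematicalPhysics.QuantumFieldTheory.Balaban1983to89.B9Eq3153FrakGLipschitzTwoBackgrounds

open B4Sect5Torus (TSite)
open B9SectCLatticeCarrier (Bond)
open B7Prop1Explicit (U1 Wcx boxVec)
open B9Eq311L2Pairing (WL2)
open B9Eq319QprimeTorus (fineP)
open B11Eq103H1Complex (SiteL2K BondL2K covDerivL2K covDivL2K laplaceAK laplaceALatticeK H1LatticeK G1LatticeK KinvLatticeK frakGLatticeK RLatticeK
  greenK G1K)
open B9Eq310HessianOperator (adTransportW hessOp)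
open B9Eq326OperatorAssembly (RofU)
open B9Eq315QTorus (perCfg cornerSite QtorusW laplaceAofBackground)
open B9Eq315QTorusOnto (liftSite perSite_liftSite QtorusW_surjective)
open B5Eq172FlatCoercivity (hU1_one hreg_one)
open B9Eq368ProjectionRemainder (norm_projR_le)
open B9Eq373DerivativeRemainderL2 (norm_covDerivL2K_le norm_covDivL2K_le)
open B9Eq373DerivativeRemainderTwoBackgrounds (norm_covDerivL2K_sub_le₂ norm_covDivL2K_sub_le₂)
open B9Eq384RemainderLetters (norm_adTransportW_sub_le)
open B9Eq368RLipschitzTwoBackgrounds (exists_RofU_sub_RofU_linear norm_adTransportW_sub_adTransportW_le)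
open B9Eq315QLipschitz (norm_QtorusW_sub_flat_le)
open B9Thm311SmallFieldGreen (norm_G1_le_of_small_field)
open B9Eq3126H1Bound (exists_H1_frakG_bound_of_small_field)
open B9Eq386ResolventLetters (norm_frakG_formula_sub_le)
open B9Eq386LipschitzH1TwoBackgrounds (exists_lipschitz_G1_H1_twoBackgrounds)
open B9Eq379QLipschitzGeneral (norm_QtorusW_sub_QtorusW_le_of_bonds)

variable {d : ℕ} (L : ℕ) [NeZero L] (m : Fin d → ℕ) [∀ i, NeZero (fineP L m i)] (hL : 1 ≤ L)
  {𝔸 : Type*} [NormedRing 𝔸] [NormedAlgebra ℂ 𝔸] [CompleteSpace 𝔸] [NormOneClass 𝔸] [StarRing 𝔸] [NormedStarGroup 𝔸] [StarModule ℂ 𝔸]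
  {W : Type*} [NormedAddCommGroup W] [InnerProductSpace ℂ W] [FiniteDimensional ℂ W] (φ : W ≃ₗ[ℂ] 𝔸) {c₀ c₁ : ℝ} [Fact (0 < c₀)] [Fact (0 < c₁)]

set_option maxHeartbeats 800000 in
/-- **`𝔊(U)` ((3.153)∕(111)) IS LIPSCHITZ IN THE BACKGROUND BETWEEN TWO SMALL-BOND BACKGROUNDS: `‖𝔊(U)x − 𝔊(U′)x‖ ≤ C₃·δ·‖x‖`** for the chain's
`frakGLatticeK` (ANY positivity ∕ surjectivity witnesses at `U` and at `U′`), at every pair of backgrounds of E162's data with `‖U(b) − 1‖, ‖U′(b) − 1‖ ≤ ε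
≤ ε₈`, `‖U(b) − U′(b)‖ ≤ δ`, `hRS`, `hRS′` — the owner's (Q3) proof with `U′` for `1`: bounds at both backgrounds, differences `δ_G = C₁δ`, `δ_H = C₂δ`
((Q2)₂), `δ_Q = C_Q·δ` ((δ_Q)₂), `δ_D = |η|⁻¹2M_φM_φ′δ√d` ((B)₂), `δ_R = C_R·δ` ((Q3a)₂), the telescoping `norm_frakG_formula_sub_le`.
[cite: Balaban1985BackgroundPropagators, (3.153) p.426, (3.147) p.425, Thm 3.4 p.400, (3.86) p.407; Balaban1985Variational, (110)–(111) p.294] -/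
theorem exists_lipschitz_frakG_twoBackgrounds {η : ℝ} (hη : η ≠ 0) {a : ℝ} (ha : 0 < a) {Mφ Mφ' : ℝ} (hMφ : 0 ≤ Mφ) (hMφ' : 0 ≤ Mφ')
    (hφ : ∀ w, ‖φ w‖ ≤ Mφ * ‖w‖) (hφ' : ∀ X, ‖φ.symm X‖ ≤ Mφ' * ‖X‖) (τ : 𝔸 →ₗ[ℂ] ℂ) {Cτ : ℝ} (hτ : ∀ X, ‖τ X‖ ≤ Cτ * ‖X‖) (hCτ : 0 ≤ Cτ) :
    ∃ C₃ ε₈ : ℝ, 0 < C₃ ∧ 0 < ε₈ ∧ ∀ (U U' : Bond d (fineP L m) → 𝔸ˣ) {α α' : ℝ} (hα1 : α ≤ 1 / 64)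
      (hU1 : ∀ (x : B7Prop1Explicit.Site d) (κ : Fin d), perCfg (fineP L m) U x κ ∈ U1 𝔸)
      (hreg : ∀ (y : TSite d m) (κ : Fin d) (r : Fin d → Fin L), ‖((Wcx L (perCfg (fineP L m) U) (cornerSite L y) κ (boxVec L r) : 𝔸ˣ) : 𝔸) - 1‖ ≤ α)
      (hα1' : α' ≤ 1 / 64)
      (hU1' : ∀ (x : B7Prop1Explicit.Site d) (κ : Fin d), perCfg (fineP L m) U' x κ ∈ U1 𝔸)
      (hreg' : ∀ (y : TSite d m) (κ : Fin d) (r : Fin d → Fin L), ‖((Wcx L (perCfg (fineP L m) U') (cornerSite L y) κ (boxVec L r) : 𝔸ˣ) : 𝔸) - 1‖ ≤ α')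
      {ε δ : ℝ}, 0 ≤ ε → ε ≤ ε₈ → 0 ≤ δ → (∀ b, ‖(U b : 𝔸) - 1‖ ≤ ε) → (∀ b, ‖(U' b : 𝔸) - 1‖ ≤ ε) →
      (∀ b, ‖(U b : 𝔸) - (U' b : 𝔸)‖ ≤ δ) →
      (∀ (b : Bond d (fineP L m)) (v u : W), ⟪adTransportW φ U b v, u⟫_ℂ = ⟪v, adTransportW φ (fun b => (U b)⁻¹) b u⟫_ℂ) →
      (∀ (b : Bond d (fineP L m)) (v u : W), ⟪adTransportW φ U' b v, u⟫_ℂ = ⟪v, adTransportW φ (fun b => (U' b)⁻¹) b u⟫_ℂ) →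
      ∀ (hpos : ∀ x : BondL2K ℂ d (fineP L m) c₀ W, x ≠ 0 →
          0 < RCLike.re ⟪x, laplaceAofBackground L m hL φ U hα1 hU1 hreg τ η (c₀ := c₀) (c₁ := c₁) a x⟫_ℂ)
        (hQ : Function.Surjective (QtorusW L m hL φ U hα1 hU1 hreg (c₀ := c₀) (c₁ := c₁)))
        (hpos' : ∀ x : BondL2K ℂ d (fineP L m) c₀ W, x ≠ 0 →
          0 < RCLike.re ⟪x, laplaceAofBackground L m hL φ U' hα1' hU1' hreg' τ η (c₀ := c₀) (c₁ := c₁) a x⟫_ℂ)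
        (hQ' : Function.Surjective (QtorusW L m hL φ U' hα1' hU1' hreg' (c₀ := c₀) (c₁ := c₁))) (x : BondL2K ℂ d (fineP L m) c₀ W),
      ‖frakGLatticeK (Δ₁ := hessOp φ η U τ) (Q := QtorusW L m hL φ U hα1 hU1 hreg (c₀ := c₀) (c₁ := c₁)) hpos hQ x -
          frakGLatticeK (Δ₁ := hessOp φ η U' τ) (Q := QtorusW L m hL φ U' hα1' hU1' hreg' (c₀ := c₀) (c₁ := c₁)) hpos' hQ' x‖ ≤
        C₃ * δ * ‖x‖ := by
  have hc₀ : 0 < c₀ := Fact.out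
  have hc : conj ((η : ℂ))⁻¹ = ((η : ℂ))⁻¹ := by rw [map_inv₀, Complex.conj_ofReal]
  have hL0 : (0 : ℝ) < L := by exact_mod_cast hL
  -- the letters' uniform bounds and two-background differences
  obtain ⟨γ₁, ε₃, hγ₁, hε₃, HG⟩ := norm_G1_le_of_small_field L m hL φ (c₀ := c₀) (c₁ := c₁) hη ha hMφ hMφ' hφ hφ' τ hτ hCτ
  obtain ⟨CH, CG', ε₅, hCH, -, hε₅, Hb⟩ := exists_H1_frakG_bound_of_small_field L m hL φ (c₀ := c₀) (c₁ := c₁) hη ha hMφ hMφ' hφ hφ' τ hτ hCτ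
  obtain ⟨C₁, C₂, ε₇, hC₁, hC₂, hε₇, HGH⟩ := exists_lipschitz_G1_H1_twoBackgrounds L m hL φ (c₀ := c₀) (c₁ := c₁) hη ha hMφ hMφ' hφ hφ' τ hτ hCτ
  obtain ⟨CR, εR₀, hCR, hεR₀, HR⟩ := exists_RofU_sub_RofU_linear L m φ (c₀ := c₀) hη hMφ hMφ' hφ hφ'
  -- constants
  obtain ⟨MQ1, hMQ1def⟩ : ∃ MQ1 : ℝ, MQ1 = ‖LinearMap.toContinuousLinearMap
    (QtorusW L m hL φ (fun _ => 1) (show (0 : ℝ) ≤ 1 / 64 by norm_num) (hU1_one L m) (hreg_one L m) (c₀ := c₀) (c₁ := c₁))‖ := ⟨_, rfl⟩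
  have hMQ1 : 0 ≤ MQ1 := by rw [hMQ1def]; positivity
  have hQ1 : ∀ x : BondL2K ℂ d (fineP L m) c₀ W,
      ‖QtorusW L m hL φ (fun _ => 1) (show (0 : ℝ) ≤ 1 / 64 by norm_num) (hU1_one L m) (hreg_one L m) (c₀ := c₀) (c₁ := c₁) x‖ ≤ MQ1 * ‖x‖ :=
    fun x => by
      rw [hMQ1def]
      exact (LinearMap.toContinuousLinearMap
        (QtorusW L m hL φ (fun _ => 1) (show (0 : ℝ) ≤ 1 / 64 by norm_num) (hU1_one L m) (hreg_one L m) (c₀ := c₀) (c₁ := c₁))).le_opNorm x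
  obtain ⟨KR, hKRdef⟩ : ∃ KR : ℝ, KR = 2 * Mφ * Mφ' := ⟨_, rfl⟩
  have hKR : 0 ≤ KR := by rw [hKRdef]; positivity
  obtain ⟨N, hNdef⟩ : ∃ N : ℝ, N = ((2 * (d * L) + L + L : ℕ) : ℝ) := ⟨_, rfl⟩
  have hN1 : (1 : ℝ) ≤ N := by
    have : 1 ≤ 2 * (d * L) + L + L := by omega
    rw [hNdef]; exact_mod_cast this
  have hN : 0 < N := by linarith
  obtain ⟨CQ, hCQdef⟩ : ∃ CQ : ℝ, CQ = Mφ' * Mφ * Real.sqrt (c₁ * Fintype.card (Bond d m) / c₀) * (102 * (d + 1) ^ 2 * L) := ⟨_, rfl⟩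
  have hCQ : 0 ≤ CQ := by rw [hCQdef]; positivity
  obtain ⟨CQ₂, hCQ₂def⟩ : ∃ CQ₂ : ℝ, CQ₂ = Mφ' * Mφ * Real.sqrt (c₁ * Fintype.card (Bond d m) / c₀) * (75497472 * ((d : ℝ) + 1) * N) := ⟨_, rfl⟩
  have hCQ₂ : 0 ≤ CQ₂ := by rw [hCQ₂def]; positivity
  obtain ⟨MD, hMDdef⟩ : ∃ MD : ℝ, MD = 2 * (1 + 1) * ‖((η : ℂ))⁻¹‖ * Real.sqrt d := ⟨_, rfl⟩
  have hMD : 0 ≤ MD := by rw [hMDdef]; positivity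
  obtain ⟨KD, hKDdef⟩ : ∃ KD : ℝ, KD = ‖((η : ℂ))⁻¹‖ * KR * Real.sqrt d := ⟨_, rfl⟩
  have hKD : 0 ≤ KD := by rw [hKDdef]; positivity
  refine ⟨C₁ + (C₂ * (MQ1 + CQ) * γ₁⁻¹ + CH * CQ₂ * γ₁⁻¹ + CH * (MQ1 + CQ) * C₁) +
      (C₁ * MD * MD * γ₁⁻¹ + γ₁⁻¹ * KD * MD * γ₁⁻¹ + γ₁⁻¹ * MD * CR * MD * γ₁⁻¹ + γ₁⁻¹ * MD * KD * γ₁⁻¹ + γ₁⁻¹ * MD * MD * C₁),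
    min ε₃ (min (1 / (KR + 1)) (min 1 (min ε₅ (min ε₇ (min εR₀ (min (1 / (256 * ((d : ℝ) + 1) * L)) (1 / (24576 * N)))))))),
    by positivity, by positivity, ?_⟩
  intro U U' α α' hα1 hU1 hreg hα1' hU1' hreg' ε δ hε hε₈ hδ hUε hU'ε hUU' hRS hRS' hpos hQs hpos' hQs' x
  have hεε₃ : ε ≤ ε₃ := hε₈.trans (min_le_left _ _)
  have hε1' : ε ≤ 1 / (KR + 1) := hε₈.trans ((min_le_right _ _).trans (min_le_left _ _))
  have hε1 : ε ≤ 1 := hε₈.trans ((min_le_right _ _).trans ((min_le_right _ _).trans (min_le_left _ _)))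
  have hεε₅ : ε ≤ ε₅ := hε₈.trans ((min_le_right _ _).trans ((min_le_right _ _).trans ((min_le_right _ _).trans (min_le_left _ _))))
  have hεε₇ : ε ≤ ε₇ :=
    hε₈.trans ((min_le_right _ _).trans ((min_le_right _ _).trans ((min_le_right _ _).trans ((min_le_right _ _).trans (min_le_left _ _)))))
  have hεεR₀ : ε ≤ εR₀ := hε₈.trans ((min_le_right _ _).trans ((min_le_right _ _).trans ((min_le_right _ _).trans ((min_le_right _ _).trans
    ((min_le_right _ _).trans (min_le_left _ _))))))
  have hεreg' : ε ≤ 1 / (256 * ((d : ℝ) + 1) * L) := hε₈.trans ((min_le_right _ _).trans ((min_le_right _ _).trans ((min_le_right _ _).trans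
    ((min_le_right _ _).trans ((min_le_right _ _).trans ((min_le_right _ _).trans (min_le_left _ _)))))))
  have hεN' : ε ≤ 1 / (24576 * N) := hε₈.trans ((min_le_right _ _).trans ((min_le_right _ _).trans ((min_le_right _ _).trans
    ((min_le_right _ _).trans ((min_le_right _ _).trans ((min_le_right _ _).trans (min_le_right _ _)))))))
  have hεR1 : KR * ε ≤ 1 := by
    refine (mul_le_mul_of_nonneg_left hε1' hKR).trans ?_
    rw [mul_one_div, div_le_one (by positivity)]; linarith
  have hεreg : 2 * ((d : ℝ) + 1) * L * ε ≤ 1 / 128 := by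
    have := mul_le_mul_of_nonneg_left hεreg' (by positivity : (0 : ℝ) ≤ 2 * ((d : ℝ) + 1) * L)
    refine this.trans (le_of_eq ?_)
    field_simp; ring
  -- the bond variables: `U(b), U′(b) ∈ U1`, transporters `K_Rε`-close to the identity, `K_Rδ₀`-close to each other
  have hUb : ∀ b : Bond d (fineP L m), U b ∈ U1 𝔸 := fun b => by
    obtain ⟨y, κ'⟩ := b
    have h := hU1 (liftSite y) κ'
    rwa [B9Eq315QTorus.perCfg_apply, perSite_liftSite] at h
  have hU'b : ∀ b : Bond d (fineP L m), U' b ∈ U1 𝔸 := fun b => by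
    obtain ⟨y, κ'⟩ := b
    have h := hU1' (liftSite y) κ'
    rwa [B9Eq315QTorus.perCfg_apply, perSite_liftSite] at h
  obtain ⟨δ₀, hδ₀def⟩ : ∃ δ₀ : ℝ, δ₀ = min δ (2 * ε) := ⟨_, rfl⟩
  have hδ₀ : 0 ≤ δ₀ := by rw [hδ₀def]; exact le_min hδ (by positivity)
  have hδ₀δ : δ₀ ≤ δ := by rw [hδ₀def]; exact min_le_left _ _
  have hδ₀N : δ₀ ≤ 1 / (12288 * ((2 * (d * L) + L + L : ℕ) : ℝ)) := by
    rw [← hNdef]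
    refine (show δ₀ ≤ 2 * ε by rw [hδ₀def]; exact min_le_right _ _).trans ?_
    have := mul_le_mul_of_nonneg_left hεN' (by norm_num : (0 : ℝ) ≤ 2)
    refine this.trans (le_of_eq ?_)
    field_simp; norm_num
  have hUU'₀ : ∀ b, ‖(U b : 𝔸) - (U' b : 𝔸)‖ ≤ δ₀ := fun b => by
    rw [hδ₀def]
    refine le_min (hUU' b) ?_
    calc ‖(U b : 𝔸) - (U' b : 𝔸)‖ = ‖((U b : 𝔸) - 1) - ((U' b : 𝔸) - 1)‖ := by rw [sub_sub_sub_cancel_right]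
      _ ≤ ‖(U b : 𝔸) - 1‖ + ‖(U' b : 𝔸) - 1‖ := norm_sub_le _ _
      _ ≤ 2 * ε := by linarith [hUε b, hU'ε b]
  have hR : ∀ (b : Bond d (fineP L m)) (w : W), ‖adTransportW φ U b w - w‖ ≤ KR * ε * ‖w‖ := fun b w => by
    have h := norm_adTransportW_sub_le φ hφ hφ' hMφ' U b (hUb b) (hUε b) w
    rw [hKRdef]; linarith
  have hR' : ∀ (b : Bond d (fineP L m)) (w : W), ‖adTransportW φ U' b w - w‖ ≤ KR * ε * ‖w‖ := fun b w => by
    have h := norm_adTransportW_sub_le φ hφ hφ' hMφ' U' b (hU'b b) (hU'ε b) w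
    rw [hKRdef]; linarith
  have hR1 : ∀ (b : Bond d (fineP L m)) (w : W), ‖adTransportW φ U b w - w‖ ≤ 1 * ‖w‖ := fun b w =>
    (hR b w).trans (mul_le_mul_of_nonneg_right hεR1 (norm_nonneg _))
  have hR'1 : ∀ (b : Bond d (fineP L m)) (w : W), ‖adTransportW φ U' b w - w‖ ≤ 1 * ‖w‖ := fun b w =>
    (hR' b w).trans (mul_le_mul_of_nonneg_right hεR1 (norm_nonneg _))
  have hRR' : ∀ (b : Bond d (fineP L m)) (w : W), ‖adTransportW φ U b w - adTransportW φ U' b w‖ ≤ KR * δ * ‖w‖ := fun b w => by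
    have h := norm_adTransportW_sub_adTransportW_le L m φ hφ hφ' hMφ' U U' b (hUb b) (hU'b b) (hUU' b) w
    rw [hKRdef]; linarith
  -- the letters' BOUNDS (at `U` and at `U′`)
  have hG₁le : ∀ z : BondL2K ℂ d (fineP L m) c₀ W,
      ‖G1LatticeK (Δ₁ := hessOp φ η U τ) (Q := QtorusW L m hL φ U hα1 hU1 hreg (c₀ := c₀) (c₁ := c₁)) hpos z‖ ≤ γ₁⁻¹ * ‖z‖ :=
    fun z => HG U hα1 hU1 hreg hε hεε₃ hUε hRS hpos z
  have hG₂le : ∀ z : BondL2K ℂ d (fineP L m) c₀ W,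
      ‖G1LatticeK (Δ₁ := hessOp φ η U' τ) (Q := QtorusW L m hL φ U' hα1' hU1' hreg' (c₀ := c₀) (c₁ := c₁)) hpos' z‖ ≤ γ₁⁻¹ * ‖z‖ :=
    fun z => HG U' hα1' hU1' hreg' hε hεε₃ hU'ε hRS' hpos' z
  have hH₂le : ∀ b : BondL2K ℂ d m c₁ W,
      ‖H1LatticeK (Δ₁ := hessOp φ η U' τ) (Q := QtorusW L m hL φ U' hα1' hU1' hreg' (c₀ := c₀) (c₁ := c₁)) hpos' hQs' b‖ ≤ CH * ‖b‖ :=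
    fun b => (Hb U' hα1' hU1' hreg' hε hεε₅ hU'ε hRS' hpos' hQs').1 b
  have hQdiff : ∀ (V : Bond d (fineP L m) → 𝔸ˣ) {β : ℝ} (hβ : β ≤ 1 / 64)
      (hV1 : ∀ (x : B7Prop1Explicit.Site d) (κ : Fin d), perCfg (fineP L m) V x κ ∈ U1 𝔸)
      (hregV : ∀ (y : TSite d m) (κ : Fin d) (r : Fin d → Fin L), ‖((Wcx L (perCfg (fineP L m) V) (cornerSite L y) κ (boxVec L r) : 𝔸ˣ) : 𝔸) - 1‖ ≤ β),
      (∀ b, ‖(V b : 𝔸) - 1‖ ≤ ε) → ∀ x : BondL2K ℂ d (fineP L m) c₀ W, ‖QtorusW L m hL φ V hβ hV1 hregV (c₁ := c₁) x -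
      QtorusW L m hL φ (fun _ => 1) (show (0 : ℝ) ≤ 1 / 64 by norm_num) (hU1_one L m) (hreg_one L m) (c₁ := c₁) x‖ ≤ CQ * ε * ‖x‖ := by
    intro V β hβ hV1 hregV hVε x
    refine (norm_QtorusW_sub_flat_le L m hL V hβ hV1 hregV (show (0 : ℝ) ≤ 1 / 64 by norm_num) (hU1_one L m) (hreg_one L m) hε hVε φ
      hMφ hφ hMφ' hφ' x).trans (le_of_eq ?_)
    rw [hCQdef]; ring
  have hQV : ∀ (V : Bond d (fineP L m) → 𝔸ˣ) {β : ℝ} (hβ : β ≤ 1 / 64)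
      (hV1 : ∀ (x : B7Prop1Explicit.Site d) (κ : Fin d), perCfg (fineP L m) V x κ ∈ U1 𝔸)
      (hregV : ∀ (y : TSite d m) (κ : Fin d) (r : Fin d → Fin L), ‖((Wcx L (perCfg (fineP L m) V) (cornerSite L y) κ (boxVec L r) : 𝔸ˣ) : 𝔸) - 1‖ ≤ β),
      (∀ b, ‖(V b : 𝔸) - 1‖ ≤ ε) → ∀ x : BondL2K ℂ d (fineP L m) c₀ W, ‖QtorusW L m hL φ V hβ hV1 hregV (c₀ := c₀) (c₁ := c₁) x‖ ≤ (MQ1 + CQ) * ‖x‖ := by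
    intro V β hβ hV1 hregV hVε x
    have h1 := hQ1 x
    have h2 := hQdiff V hβ hV1 hregV hVε x
    have h3 := norm_le_insert' (QtorusW L m hL φ V hβ hV1 hregV (c₀ := c₀) (c₁ := c₁) x)
      (QtorusW L m hL φ (fun _ => 1) (show (0 : ℝ) ≤ 1 / 64 by norm_num) (hU1_one L m) (hreg_one L m) (c₀ := c₀) (c₁ := c₁) x)
    have h4 : CQ * ε * ‖x‖ ≤ CQ * ‖x‖ := mul_le_mul_of_nonneg_right (mul_le_of_le_one_right hCQ hε1) (norm_nonneg x)
    linarith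
  have hQU := hQV U hα1 hU1 hreg hUε
  have hQU' := hQV U' hα1' hU1' hreg' hU'ε
  have hD₁le : ∀ s : SiteL2K ℂ d (fineP L m) c₀ W, ‖covDerivL2K ℂ c₀ ((η : ℂ))⁻¹ (adTransportW φ U) s‖ ≤ MD * ‖s‖ := fun s => by
    rw [hMDdef]; exact norm_covDerivL2K_le _ zero_le_one hR1 s
  have hD₂le : ∀ s : SiteL2K ℂ d (fineP L m) c₀ W, ‖covDerivL2K ℂ c₀ ((η : ℂ))⁻¹ (adTransportW φ U') s‖ ≤ MD * ‖s‖ := fun s => by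
    rw [hMDdef]; exact norm_covDerivL2K_le _ zero_le_one hR'1 s
  have hDs₁le : ∀ x : BondL2K ℂ d (fineP L m) c₀ W, ‖covDivL2K ℂ c₀ ((η : ℂ))⁻¹ (adTransportW φ fun b => (U b)⁻¹) x‖ ≤ MD * ‖x‖ := fun x => by
    rw [hMDdef]; exact norm_covDivL2K_le _ hc zero_le_one hR1 hRS x
  have hDs₂le : ∀ x : BondL2K ℂ d (fineP L m) c₀ W, ‖covDivL2K ℂ c₀ ((η : ℂ))⁻¹ (adTransportW φ fun b => (U' b)⁻¹) x‖ ≤ MD * ‖x‖ := fun x => by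
    rw [hMDdef]; exact norm_covDivL2K_le _ hc zero_le_one hR'1 hRS' x
  have hRr₁ : ∀ s : SiteL2K ℂ d (fineP L m) c₀ W, ‖RofU L m φ η U s‖ ≤ ‖s‖ := fun s => by
    unfold RofU RLatticeK; exact norm_projR_le _ _ s
  have hRr₂ : ∀ s : SiteL2K ℂ d (fineP L m) c₀ W, ‖RofU L m φ η U' s‖ ≤ ‖s‖ := fun s => by
    unfold RofU RLatticeK; exact norm_projR_le _ _ s
  -- the letters' DIFFERENCES
  obtain ⟨hGsub, hHsub⟩ := HGH U U' hα1 hU1 hreg hα1' hU1' hreg' hε hεε₇ hδ hUε hU'ε hUU' hRS hRS' hpos hQs hpos' hQs'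
  have hQsub : ∀ x : BondL2K ℂ d (fineP L m) c₀ W, ‖QtorusW L m hL φ U hα1 hU1 hreg (c₀ := c₀) (c₁ := c₁) x -
      QtorusW L m hL φ U' hα1' hU1' hreg' (c₀ := c₀) (c₁ := c₁) x‖ ≤ CQ₂ * δ * ‖x‖ := fun x => by
    refine (norm_QtorusW_sub_QtorusW_le_of_bonds L m hL U hα1 hU1 hreg U' hα1' hU1' hreg' hε hU'ε hεreg hδ₀ hδ₀N hUU'₀ φ
      (c₀ := c₀) (c₁ := c₁) hMφ hφ hMφ' hφ' x).trans ?_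
    have h1 : Mφ' * Mφ * Real.sqrt (c₁ * Fintype.card (Bond d m) / c₀) * (75497472 * ((d : ℝ) + 1) * ((2 * (d * L) + L + L : ℕ) : ℝ) * δ₀) * ‖x‖
        = CQ₂ * δ₀ * ‖x‖ := by rw [hCQ₂def, hNdef]; ring
    rw [h1]
    exact mul_le_mul_of_nonneg_right (mul_le_mul_of_nonneg_left hδ₀δ hCQ₂) (norm_nonneg _)
  have hDsub : ∀ s : SiteL2K ℂ d (fineP L m) c₀ W,
      ‖covDerivL2K ℂ c₀ ((η : ℂ))⁻¹ (adTransportW φ U) s - covDerivL2K ℂ c₀ ((η : ℂ))⁻¹ (adTransportW φ U') s‖ ≤ KD * δ * ‖s‖ := fun s => by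
    have h := norm_covDerivL2K_sub_le₂ ((η : ℂ))⁻¹ (show 0 ≤ KR * δ by positivity) hRR' s
    rw [hKDdef]; refine h.trans (le_of_eq ?_); ring
  have hDssub : ∀ x : BondL2K ℂ d (fineP L m) c₀ W,
      ‖covDivL2K ℂ c₀ ((η : ℂ))⁻¹ (adTransportW φ fun b => (U b)⁻¹) x - covDivL2K ℂ c₀ ((η : ℂ))⁻¹ (adTransportW φ fun b => (U' b)⁻¹) x‖ ≤
        KD * δ * ‖x‖ := fun x => by
    have h := norm_covDivL2K_sub_le₂ ((η : ℂ))⁻¹ hc (show 0 ≤ KR * δ by positivity) hRR' hRS hRS' x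
    rw [hKDdef]; refine h.trans (le_of_eq ?_); ring
  have hRsub : ∀ s : SiteL2K ℂ d (fineP L m) c₀ W, ‖RofU L m φ η U s - RofU L m φ η U' s‖ ≤ CR * δ * ‖s‖ :=
    fun s => HR U U' hε hεεR₀ hδ hUb hU'b hUε hU'ε hUU' hRS hRS' s
  -- the two `𝔊`'s in the form of the telescoping lemma (`H₁ = G₁Q†K⁻¹` by `rfl`)
  have eV : ∀ (V : Bond d (fineP L m) → 𝔸ˣ) {β : ℝ} (hβ : β ≤ 1 / 64)
      (hV1 : ∀ (x : B7Prop1Explicit.Site d) (κ : Fin d), perCfg (fineP L m) V x κ ∈ U1 𝔸)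
      (hregV : ∀ (y : TSite d m) (κ : Fin d) (r : Fin d → Fin L), ‖((Wcx L (perCfg (fineP L m) V) (cornerSite L y) κ (boxVec L r) : 𝔸ˣ) : 𝔸) - 1‖ ≤ β)
      (hposV : ∀ x : BondL2K ℂ d (fineP L m) c₀ W, x ≠ 0 →
          0 < RCLike.re ⟪x, laplaceAofBackground L m hL φ V hβ hV1 hregV τ η (c₀ := c₀) (c₁ := c₁) a x⟫_ℂ)
      (hQV' : Function.Surjective (QtorusW L m hL φ V hβ hV1 hregV (c₀ := c₀) (c₁ := c₁))),
      frakGLatticeK (Δ₁ := hessOp φ η V τ) (Q := QtorusW L m hL φ V hβ hV1 hregV (c₀ := c₀) (c₁ := c₁)) hposV hQV' x =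
      G1LatticeK (Δ₁ := hessOp φ η V τ) (Q := QtorusW L m hL φ V hβ hV1 hregV (c₀ := c₀) (c₁ := c₁)) hposV x -
        H1LatticeK (Δ₁ := hessOp φ η V τ) (Q := QtorusW L m hL φ V hβ hV1 hregV (c₀ := c₀) (c₁ := c₁)) hposV hQV'
          (QtorusW L m hL φ V hβ hV1 hregV (c₀ := c₀) (c₁ := c₁)
            (G1LatticeK (Δ₁ := hessOp φ η V τ) (Q := QtorusW L m hL φ V hβ hV1 hregV (c₀ := c₀) (c₁ := c₁)) hposV x)) -
        G1LatticeK (Δ₁ := hessOp φ η V τ) (Q := QtorusW L m hL φ V hβ hV1 hregV (c₀ := c₀) (c₁ := c₁)) hposV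
          (covDerivL2K ℂ c₀ ((η : ℂ))⁻¹ (adTransportW φ V) (RofU L m φ η V (covDivL2K ℂ c₀ ((η : ℂ))⁻¹ (adTransportW φ fun b => (V b)⁻¹)
            (G1LatticeK (Δ₁ := hessOp φ η V τ) (Q := QtorusW L m hL φ V hβ hV1 hregV (c₀ := c₀) (c₁ := c₁)) hposV x)))) := by
    intro V β hβ hV1 hregV hposV hQV'
    unfold frakGLatticeK
    rw [B11Eq111FrakG.frakGLin_apply]
    rfl
  rw [eV U hα1 hU1 hreg hpos hQs, eV U' hα1' hU1' hreg' hpos' hQs']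
  refine (norm_frakG_formula_sub_le (𝕜 := ℂ) _ _ _ _ _ _ _ _ _ _ _ _ (by positivity) hCH.le (by positivity) hMD (by positivity) (by positivity)
    (by positivity) (by positivity) (by positivity) hG₁le hG₂le hH₂le hQU hQU' hD₁le hD₂le hDs₁le hDs₂le hRr₁ hRr₂ hGsub hHsub hQsub hDsub
    hDssub hRsub x).trans (le_of_eq ?_)
  ring

end Literature.MathematicalPhysics.QuantumFieldTheory.Balaban1983to89.B9Eq3153FrakGLipschitzTwoBackgrounds

end
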